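import Summits.CriticalPhenomena.PercolationContinuityZ3.Theorems.Transplant.SkelNegParamsLattice
import HarnessLib

/-!
# N1 params, part 0c-A (q-free, consumer-independent): THE LONG CELL LATTICE WITH THE COARSE-LATTICE CONSTANT `A` AS A PARAMETER — `DofA A n h ℓ v_α :=
# detD A n h v_α v_β` (`= A²·modulus`, `v_β := vβOf …`), and the two resolution discharges `hL1_of_floorsA` / `hL0_of_floorsA` for EVERY `A ≥ 800`
# (stmt-g16 2026-08-22; the (ζ′) re-version of NEG-SCOPE §B.19 / FEASIBILITY §ζ′: 'make A a parameter once', p3-g11 01:45:32Z / 01:52:01Z (3))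
Today's toolkit (`SkelNegParamsLattice`, p272834) fixes `A := 800` (`NegPrm.Dof := detD 800 …`); the (ζ′) chain instantiates `A := 20·K = 800·Kq` (then the fine
resolution `c_i = 20K·s_i` equals `A·s_i`, so one lattice period `u` reads as `s_i` cells — 'κ₀ := s∥' — and the multipliers `⌊D_A/(20K·A·L̂_i)⌋` are `⌊modulus/L̂_i⌋`).
The resolution inequalities `20K·(|A|·L̂_i)·s ≤ D_A` need only `800 ≤ A`: they are today's `hL1_of_floors` / `hL0_of_floors` (slack `40 = 800/20`) scaled by `A/800`.
Nothing of record changes: `Dof = DofA 800` (`rfl`).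
builds on p205010 (kernel theorem, internal audit signed; external expert review pending) — nothing in this file uses p205010; NOTHING is claimed about the node
`SamePDropOfSkeletonNeg₁` (OPEN; additive closure adopted on accept, lead g7 01:38:43Z).
Lane `prim-bschramm-*`, seat `prim-bschramm-stmt` (gen 16); helper file (`--supports stmt-CriticalPhenomena-4575 --as helper`); ledger HOME/prim-bschramm-stmt/NEG-PARAMS.md.
* §1 **`DofA`**, `DofA_eq`, `DofA_pos`, `Dof_eq_DofA`, `detDA_vβOf_pos`; §2 **`hL1_of_floorsA`**, **`hL0_of_floorsA`** (`800 ≤ A`), `lip_coarseSkel_of_floorsA`,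
  `coarse_containment_of_floorsA`.
[cite: MartineauTassion2017, §4.1–4.3 (the cell lattice generated by u and v)] [cite: KozmaNitzan2024, §4 Lemma 10 Step IV (siting by planar position)]
-/

namespace Summit.CriticalPhenomena.PercolationContinuityZ3.Theorems.Transplant

namespace Skelφ

namespace NegPrm

open Literature.Probability.Percolation Literature.Probability.LatticeModels SimpleGraph TwoAxis.Para

/-! ## §1 The determinant with `A` a parameter -/

/-- **The determinant of the long cell lattice `[A·u A·v]`**: `D_A := detD A n h v_α v_β = A²·(n·v_β − h·v_α)`, `v_β := vβOf n h ℓ v_α`. [this work] -/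
def DofA (A : ℤ) (n : ℕ) (h : ℤ) (ℓ : ℕ) (vα : ℤ) : ℤ := detD A n h vα (vβOf n h ℓ vα)

/-- `D_A = A²·modulus`. [folklore] -/
theorem DofA_eq (A : ℤ) (n : ℕ) (h : ℤ) (ℓ : ℕ) (vα : ℤ) : DofA A n h ℓ vα = A ^ 2 * modulus n h vα (vβOf n h ℓ vα) := rfl

/-- The ledger's `Dof` is `DofA 800`. [folklore] -/
theorem Dof_eq_DofA (n : ℕ) (h : ℤ) (ℓ : ℕ) (vα : ℤ) : Dof n h ℓ vα = DofA 800 n h ℓ vα := rfl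

/-- `0 < detD A n h v_α v_β` for `A ≠ 0` (`1 ≤ n`, `1 ≤ ℓ`). [folklore] -/
theorem detDA_vβOf_pos {A : ℤ} (hA : A ≠ 0) {n ℓ : ℕ} (hn : 1 ≤ n) (hℓ : 1 ≤ ℓ) (h vα : ℤ) : 0 < detD A n h vα (vβOf n h ℓ vα) := by
  have hm := modulus_vβOf_pos hn hℓ h vα
  have hA2 : 0 < A ^ 2 := by positivity
  unfold detD
  positivity

/-- `0 < D_A` (`A ≠ 0`, `1 ≤ n`, `1 ≤ ℓ`). [folklore] -/
theorem DofA_pos {A : ℤ} (hA : A ≠ 0) {n ℓ : ℕ} (hn : 1 ≤ n) (hℓ : 1 ≤ ℓ) (h vα : ℤ) : 0 < DofA A n h ℓ vα := detDA_vβOf_pos hA hn hℓ h vα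

/-! ## §2 The resolution discharges for every `A ≥ 800` -/

/-- **`hL1` from the floors, any `A ≥ 800`**: with `K·s + 2 ≤ M` and the long-scale facts, `20K·(|A|·(|n| + |h|))·s ≤ detD A n h v_α v_β` (today's `hL1_of_floors`
scaled by `A/800`). [this work] -/
theorem hL1_of_floorsA {A : ℤ} (hA : 800 ≤ A) {K s M : ℤ} {n ℓ : ℕ} {h vα vβ : ℤ} (hK : 0 ≤ K) (hs : 0 ≤ s) (hM : K * s + 2 ≤ M) (hn : M + 1 ≤ n)
    (hℓ : M + 1 ≤ ℓ) (hlay₁ : (M + 1) * ((n : ℤ) + |h|) ≤ (n : ℤ) * ((ℓ : ℤ) + 1))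
    (hlay : (n : ℤ) * ℓ - (n + |h|) < modulus n h vα vβ ∧ modulus n h vα vβ ≤ n * ℓ) :
    20 * K * (|A| * (|(n : ℤ)| + |h|) * s) ≤ 1 * detD A n h vα vβ := by
  have h8 := hL1_of_floors hK hs hM hn hℓ hlay₁ hlay
  rw [one_mul, detD, abs_of_nonneg (by norm_num : (0 : ℤ) ≤ 800)] at h8
  have hA0 : 0 ≤ A := by linarith
  have hmod : 0 ≤ modulus n h vα vβ := by
    have : (0 : ℤ) ≤ 20 * K * (800 * (|(n : ℤ)| + |h|) * s) := by positivity
    nlinarith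
  -- divide today's inequality by `800`
  have hdiv : 20 * K * ((|(n : ℤ)| + |h|) * s) ≤ 800 * modulus n h vα vβ := by nlinarith
  rw [one_mul, detD, abs_of_nonneg hA0]
  calc 20 * K * (A * (|(n : ℤ)| + |h|) * s) = A * (20 * K * ((|(n : ℤ)| + |h|) * s)) := by ring
    _ ≤ A * (800 * modulus n h vα vβ) := mul_le_mul_of_nonneg_left hdiv hA0
    _ ≤ A * (A * modulus n h vα vβ) := mul_le_mul_of_nonneg_left (mul_le_mul_of_nonneg_right hA hmod) hA0
    _ = A ^ 2 * modulus n h vα vβ := by ring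

/-- **`hL0` from the floors, any `A ≥ 800`**: with the stronger floor `4·K·s + 2 ≤ M`, `20K·(|A|·(|v_β| + |v_α|))·s ≤ detD A n h v_α v_β`. [this work] -/
theorem hL0_of_floorsA {A : ℤ} (hA : 800 ≤ A) {K s M : ℤ} {n ℓ : ℕ} {h vα vβ : ℤ} (hK : 0 ≤ K) (hs : 0 ≤ s) (hM : 4 * K * s + 2 ≤ M) (hn : M + 1 ≤ n)
    (hℓ : M + 1 ≤ ℓ) (hlay₁ : (M + 1) * ((n : ℤ) + |h|) ≤ (n : ℤ) * ((ℓ : ℤ) + 1)) (hv : |vα| ≤ (n : ℤ))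
    (hlay : (n : ℤ) * ℓ - (n + |h|) < modulus n h vα vβ ∧ modulus n h vα vβ ≤ n * ℓ) :
    20 * K * (|A| * (|vβ| + |vα|) * s) ≤ 1 * detD A n h vα vβ := by
  have h8 := hL0_of_floors hK hs hM hn hℓ hlay₁ hv hlay
  rw [one_mul, detD, abs_of_nonneg (by norm_num : (0 : ℤ) ≤ 800)] at h8
  have hA0 : 0 ≤ A := by linarith
  have hmod : 0 ≤ modulus n h vα vβ := by
    have : (0 : ℤ) ≤ 20 * K * (800 * (|vβ| + |vα|) * s) := by positivity
    nlinarith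
  have hdiv : 20 * K * ((|vβ| + |vα|) * s) ≤ 800 * modulus n h vα vβ := by nlinarith
  rw [one_mul, detD, abs_of_nonneg hA0]
  calc 20 * K * (A * (|vβ| + |vα|) * s) = A * (20 * K * ((|vβ| + |vα|) * s)) := by ring
    _ ≤ A * (800 * modulus n h vα vβ) := mul_le_mul_of_nonneg_left hdiv hA0
    _ ≤ A * (A * modulus n h vα vβ) := mul_le_mul_of_nonneg_left (mul_le_mul_of_nonneg_right hA hmod) hA0
    _ = A ^ 2 * modulus n h vα vβ := by ring

variable {V : Type} {G : SimpleGraph V} {φ : V → Site 2}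

/-- **ρ-Lip from the floors, any `A ≥ 800`**: the coarse skeleton of the cell lattice `[A·u A·v]` at resolution `c = 20K` is 1-Lipschitz under `4K + 2 ≤ M_L` and the
long-scale facts (twin of `lip_coarseSkel_of_floors`). [this work] -/
theorem lip_coarseSkel_of_floorsA {A : ℤ} (hA : 800 ≤ A) (hlip : Lip G φ) (t : V) {K M : ℤ} {n ℓ : ℕ} {h vα vβ s₀ s₁ : ℤ} (hK : 0 ≤ K)
    (hM : 4 * K + 2 ≤ M) (hn : M + 1 ≤ n) (hℓ : M + 1 ≤ ℓ) (hlay₁ : (M + 1) * ((n : ℤ) + |h|) ≤ (n : ℤ) * ((ℓ : ℤ) + 1)) (hv : |vα| ≤ (n : ℤ))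
    (hlay : (n : ℤ) * ℓ - (n + |h|) < modulus n h vα vβ ∧ modulus n h vα vβ ≤ n * ℓ) :
    Lip G (coarseSkel φ t A n h vα vβ (20 * K) s₀ s₁ (detD A n h vα vβ)) := by
  have hD : 0 < detD A n h vα vβ := by
    rw [detD]
    have : (0 : ℤ) < modulus n h vα vβ := by nlinarith [hlay.1, abs_nonneg h, hM, hK]
    have hA2 : 0 < A ^ 2 := by positivity
    positivity
  have h1 := hL1_of_floorsA hA (s := 1) hK zero_le_one (by linarith) hn hℓ hlay₁ hlay
  have h0 := hL0_of_floorsA hA (s := 1) hK zero_le_one (by linarith) hn hℓ hlay₁ hv hlay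
  rw [mul_one, one_mul] at h1 h0
  exact lip_coarseSkel hlip t (by linarith) hD h0 h1

/-- **Coarse reading of a kit displacement, any `A ≥ 800`** (`c_R′ = 1`): planar distance `≤ s` in each coordinate and `4K·s + 2 ≤ M_L` give coarse positions at
distance `≤ 1` in each coordinate (twin of `coarse_containment_of_floors`). [this work] -/
theorem coarse_containment_of_floorsA {A : ℤ} (hA : 800 ≤ A) (t : V) {K M s : ℤ} {n ℓ : ℕ} {h vα vβ s₀ s₁ : ℤ} (hK : 0 ≤ K) (hs : 0 ≤ s)
    (hM : 4 * K * s + 2 ≤ M) (hn : M + 1 ≤ n) (hℓ : M + 1 ≤ ℓ) (hlay₁ : (M + 1) * ((n : ℤ) + |h|) ≤ (n : ℤ) * ((ℓ : ℤ) + 1)) (hv : |vα| ≤ (n : ℤ))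
    (hlay : (n : ℤ) * ℓ - (n + |h|) < modulus n h vα vβ ∧ modulus n h vα vβ ≤ n * ℓ)
    {w w' : V} (h0 : |φ w 0 - φ w' 0| ≤ s) (h1 : |φ w 1 - φ w' 1| ≤ s) (i : Fin 2) :
    |coarseSkel φ t A n h vα vβ (20 * K) s₀ s₁ (detD A n h vα vβ) w i -
        coarseSkel φ t A n h vα vβ (20 * K) s₀ s₁ (detD A n h vα vβ) w' i| ≤ 1 := by
  have hD : 0 < detD A n h vα vβ := by
    rw [detD]
    have : (0 : ℤ) < modulus n h vα vβ := by nlinarith [hlay.1, abs_nonneg h, hM, mul_nonneg hK hs]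
    have hA2 : 0 < A ^ 2 := by positivity
    positivity
  have hM1 : K * s + 2 ≤ M := by nlinarith [mul_nonneg hK hs]
  have hL1 := hL1_of_floorsA hA hK hs hM1 hn hℓ hlay₁ hlay
  have hL0 := hL0_of_floorsA hA hK hs hM hn hℓ hlay₁ hv hlay
  exact coarse_containment t (by linarith) hD hL0 hL1 h0 h1 i

end NegPrm

end Skelφ

end Summit.CriticalPhenomena.PercolationContinuityZ3.Theorems.Transplant
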